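import Summits.MatrixMultiplication.MatrixMultiplication.Theorems.FarEdgeDescentGenericDomination
import HarnessLib

/-!
# Far-edge descent, Kernel X-a — rank-one coupling on the BCZ stratum line

Support for `Summit.MatrixMultiplication.MatrixMultiplication.Theses.FarEdgeDescent`
(aside `SubLogRate`; lens «structural dichotomy (special vs generic)», generation 35).

The weight family `𝔖(q) = fam K q = weightedStar K 2 1 (famW K q)` of
`FarEdgeDescentWeightFamily` is an affine line `𝔖(q) = 𝔖(0) + q • E` (`line_eq_fam`) whose
direction `E = 𝔖(1) − 𝔖(0)` is a **single triad** (Bläser–Christandl–Zuiddam's `⟨2,2,2⟩_q`,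
Def. 5 of [BCZ17], in the tree's twisted coordinates): `fam_one_sub_fam_zero`.  Consequently every
two members of the line differ by a tensor of rank `≤ 1`, and every point `F` of Strassen's
asymptotic spectrum — being monotone under restriction, additive under `⊕` and bounded by rank —
satisfies the **rank-one coupling**

* `|F(𝔖(q)) − F(𝔖(q'))| ≤ 1` (`abs_spectralPoint_fam_sub_le_one`), hence by Strassen duality
  `|R̃(𝔖(q)) − R̃(𝔖(q'))| ≤ 1` (`abs_asymptoticRank_fam_sub_le_one`).

§1 proves the general facts: `F(s + t) ≤ F(s) + F(t)` (via `s + t ≤ s ⊕ t`), `F(c • t) ≤ F(t)`,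
finite sums, and the Lipschitz bounds `|F(s + t) − F(s)| ≤ R(t)`, `|R̃(s + t) − R̃(s)| ≤ R(t)`.
Over `ℂ` (§3) the coupling pins the line to a window of width two around `R̃(𝔖(1)) = 2^ω`:

* `2^ω − 1 ≤ R̃(𝔖(q)) ≤ 2^ω + 1` for **every** `q` — in particular the generic value satisfies
  `2^ω ≤ r_gen ≤ 2^ω + 1` (`generic_window`), so the special/generic gap of the lens is at most one;
* an **additive exponent door valid at every member, including the degenerate one `q = 0`**:
  `R̃(𝔖(q)) ≤ r ⟹ ω ≤ log₂ (r + 1)` (`omega_le_logb_of_asymptoticRank_fam_le`; the Cohn–Umans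
  door `summit_of_asymptoticRank_fam_le_four` needs `q ≠ 0`);
* under the summit `ω = 2`: every member has `R̃(𝔖(q)) ≤ 5` and every universal spectral point
  takes values in `[F(𝔖(q)) ≤ 5]`; the flat-locus dichotomy sharpens to
  `(∀ q, R̃(𝔖(q)) ≤ 4) ∨ (the flat locus is finite, contains 1, and R̃ ≤ 5 everywhere)`
  (`summit_dichotomy`).  §1–§2 hold over an arbitrary field.

## References

* M. Bläser, M. Christandl, J. Zuiddam, *The border support rank of two-by-two matrix
  multiplication is seven*, arXiv:1705.09652 (2017), §2, Def. 5 (`⟨2,2,2⟩_q`), proof of Thm. 2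
  ("(sandwich) gives `R(⟨2,2,2⟩₀) ≤ 6` and thus `R(⟨2,2,2⟩_q) ≤ 7`"). [BlaserChristandlZuiddam2017]
* V. Strassen, *The asymptotic spectrum of tensors*, J. reine angew. Math. 384 (1988) — duality
  `R̃ = max over Δ`. [Strassen1988]
* M. Christandl, P. Vrana, J. Zuiddam, *Universal points in the asymptotic spectrum of tensors*,
  J. AMS 36 (2023), §1.1–1.2. [ChristandlVranaZuiddam2023]
* M. Christandl, K. Hoeberechts, H. Nieuwboer, P. Vrana, J. Zuiddam, *Asymptotic tensor rank is
  characterized by polynomials*, arXiv:2411.15789, Thm. 1.2, §3. [ChristandlHoeberechtsNieuwboerVranaZuiddam2025]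
-/

noncomputable section

open scoped BigOperators

set_option linter.dupNamespace false

namespace Summit.MatrixMultiplication.MatrixMultiplication.Theorems.FarEdgeDescentRankOneCoupling

open Literature.Computability.AlgebraicComplexity
open Summit.MatrixMultiplication.MatrixMultiplication.Theorems.FarEdgeDescentSignTwist
open Summit.MatrixMultiplication.MatrixMultiplication.Theorems.FarEdgeDescentSignTwistDet
open Summit.MatrixMultiplication.MatrixMultiplication.Theorems.FarEdgeDescentWeightFamily
open Summit.MatrixMultiplication.MatrixMultiplication.Theorems.FarEdgeDescentSupportStratumDoor
open Summit.MatrixMultiplication.MatrixMultiplication.Theorems.FarEdgeDescentStratumPinning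
open Summit.MatrixMultiplication.MatrixMultiplication.Theorems.FarEdgeDescentGenericDomination

/-! ## §1 Universal spectral points under sums and rank-one perturbations -/

section Spectral

variable {K : Type} [Field K] {ι κ μ : Type} [Fintype ι] [Fintype κ] [Fintype μ]
  [DecidableEq ι] [DecidableEq κ] [DecidableEq μ]

/-- **Subadditivity under sums**: `F(s + t) ≤ F(s) + F(t)` for every universal spectral point,
because `s + t` is a restriction of `s ⊕ t` (identify the two copies of each index set) and `F` is
`⊕`-additive. [cite: Strassen1988, §2; BurgisserClausenShokrollahi1997, (14.23)] -/
theorem spectralPoint_add_le {F : SpectralMap K} (hF : IsUniversalSpectralPoint K F)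
    (s t : ι → κ → μ → K) : F (s + t) ≤ F s + F t := by
  have hres : TensorRestrictsTo (directSumTensor s t) (s + t) := by
    refine ⟨fun a' x => Sum.elim (fun a => if a = a' then 1 else 0) (fun a => if a = a' then 1 else 0) x,
      fun b' y => Sum.elim (fun b => if b = b' then 1 else 0) (fun b => if b = b' then 1 else 0) y,
      fun c' z => Sum.elim (fun c => if c = c' then 1 else 0) (fun c => if c = c' then 1 else 0) z,
      fun a' b' c' => ?_⟩
    simp only [Fintype.sum_sum_type, Sum.elim_inl, Sum.elim_inr, directSumTensor_inl,
      directSumTensor_inr, directSumTensor_inl_inr, directSumTensor_inr_inl, mul_zero,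
      Finset.sum_const_zero, add_zero, zero_add]
    have h₁ : ∀ (T : ι → κ → μ → K), (∑ a, ∑ b, ∑ c, (if a = a' then (1 : K) else 0) *
        (if b = b' then 1 else 0) * (if c = c' then 1 else 0) * T a b c) = T a' b' c' := by
      intro T
      rw [Finset.sum_eq_single a' (fun a _ ha => by simp [ha]) (by simp),
        Finset.sum_eq_single b' (fun b _ hb => by simp [hb]) (by simp),
        Finset.sum_eq_single c' (fun c _ hc => by simp [hc]) (by simp)]
      simp
    have h₂ : (∑ a : ι, ∑ b : κ, ∑ c : μ, (if a = a' then (1 : K) else 0) *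
        (if b = b' then 1 else 0) * (if c = c' then 1 else 0) *
          directSumTensor s t (Sum.inl a) (Sum.inl b) (Sum.inr c)) = 0 :=
      Finset.sum_eq_zero fun a _ => Finset.sum_eq_zero fun b _ => Finset.sum_eq_zero fun c _ => by
        simp [directSumTensor]
    have h₃ : (∑ a : ι, ∑ b : κ, ∑ c : μ, (if a = a' then (1 : K) else 0) *
        (if b = b' then 1 else 0) * (if c = c' then 1 else 0) *
          directSumTensor s t (Sum.inr a) (Sum.inr b) (Sum.inl c)) = 0 :=
      Finset.sum_eq_zero fun a _ => Finset.sum_eq_zero fun b _ => Finset.sum_eq_zero fun c _ => by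
        simp [directSumTensor]
    simp only [Finset.sum_add_distrib]
    rw [h₁ s, h₁ t, h₂, h₃, Pi.add_apply, Pi.add_apply, Pi.add_apply]
    ring
  calc F (s + t) ≤ F (directSumTensor s t) := hF.mono _ _ hres
    _ = F s + F t := hF.map_directSum s t

/-- **Scalars do not increase spectral values**: `F(c • t) ≤ F(t)` (`c • t` is a restriction of
`t`; for `c ≠ 0` this is an equality, not needed here). [cite: Strassen1988, §2] -/
theorem spectralPoint_smul_le {F : SpectralMap K} (hF : IsUniversalSpectralPoint K F)
    (c : K) (t : ι → κ → μ → K) : F (c • t) ≤ F t := by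
  have hres : TensorRestrictsTo t (c • t) := by
    refine ⟨fun a' a => if a = a' then c else 0, fun b' b => if b = b' then 1 else 0,
      fun c' x => if x = c' then 1 else 0, fun a' b' c' => ?_⟩
    rw [Finset.sum_eq_single a' (fun a _ ha => by simp [ha]) (by simp),
      Finset.sum_eq_single b' (fun b _ hb => by simp [hb]) (by simp),
      Finset.sum_eq_single c' (fun x _ hx => by simp [hx]) (by simp)]
    simp [Pi.smul_apply, smul_eq_mul]
  exact hF.mono _ _ hres

/-- **Subadditivity over finite sums**: `F(∑ⱼ tⱼ) ≤ ∑ⱼ F(tⱼ)`. [cite: Strassen1988, §2] -/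
theorem spectralPoint_sum_le {F : SpectralMap K} (hF : IsUniversalSpectralPoint K F)
    {β : Type*} (S : Finset β) (t : β → ι → κ → μ → K) :
    F (∑ j ∈ S, t j) ≤ ∑ j ∈ S, F (t j) := by
  classical
  induction S using Finset.induction_on with
  | empty => simp [hF.map_zero]
  | insert j S hj ih =>
    rw [Finset.sum_insert hj, Finset.sum_insert hj]
    exact (spectralPoint_add_le hF _ _).trans (by linarith)

/-- **Rank-Lipschitz bound for spectral points**: `|F(s + t) − F(s)| ≤ R(t)` — adding a tensor of
rank `r` moves every universal spectral value by at most `r` (subadditivity both ways and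
`F ≤ R`). [cite: Strassen1988, §2; ChristandlVranaZuiddam2023, §1.1] -/
theorem abs_spectralPoint_add_sub_le {F : SpectralMap K} (hF : IsUniversalSpectralPoint K F)
    (s t : ι → κ → μ → K) : |F (s + t) - F s| ≤ tensorRank t := by
  rw [abs_sub_le_iff]
  refine ⟨?_, ?_⟩
  · have h₁ := spectralPoint_add_le hF s t
    have h₂ := hF.le_tensorRank t
    linarith
  · have h₁ : F s ≤ F (s + t) + F (-t) := by
      have h := spectralPoint_add_le hF (s + t) (-t)
      rwa [add_neg_cancel_right] at h
    have h₂ : F (-t) ≤ tensorRank t := by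
      refine (hF.le_tensorRank _).trans ?_
      have h' := tensorRank_smul_le (-1 : K) t
      rw [neg_one_smul] at h'
      exact_mod_cast h'
    linarith

/-- **Rank-Lipschitz bound along a pencil**: `|F(t₀ + q•t₁) − F(t₀ + q'•t₁)| ≤ R(t₁)` for all
parameters `q, q'`. [cite: ChristandlVranaZuiddam2023, §1.1] -/
theorem abs_spectralPoint_line_sub_le {F : SpectralMap K} (hF : IsUniversalSpectralPoint K F)
    (t₀ t₁ : ι → κ → μ → K) (q q' : K) :
    |F (t₀ + q • t₁) - F (t₀ + q' • t₁)| ≤ tensorRank t₁ := by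
  have e : t₀ + q' • t₁ + (q - q') • t₁ = t₀ + q • t₁ := by rw [sub_smul]; abel
  have h := abs_spectralPoint_add_sub_le hF (t₀ + q' • t₁) ((q - q') • t₁)
  rw [e] at h
  exact h.trans (by exact_mod_cast tensorRank_smul_le (q - q') t₁)

/-- **`R̃(s + t) ≤ R̃(s) + R(t)`**: asymptotic rank is rank-Lipschitz (Strassen duality: evaluate a
spectral point attaining `R̃(s + t)`). [cite: Strassen1988, Thm. 3.9; ChristandlVranaZuiddam2023, §1.1] -/
theorem asymptoticRank_add_le_add_tensorRank (s t : ι → κ → μ → K) :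
    asymptoticRank (s + t) ≤ asymptoticRank s + tensorRank t := by
  obtain ⟨F, hF, hFst⟩ := (strassen_duality_asymptoticRank_holds K (s + t)).2
  rw [← hFst]
  exact (spectralPoint_add_le hF s t).trans
    (add_le_add ((strassen_duality_asymptoticRank_holds K s).1 F hF) (hF.le_tensorRank t))

/-- **`|R̃(s + t) − R̃(s)| ≤ R(t)`**. [cite: Strassen1988, Thm. 3.9] -/
theorem abs_asymptoticRank_add_sub_le (s t : ι → κ → μ → K) :
    |asymptoticRank (s + t) - asymptoticRank s| ≤ tensorRank t := by
  rw [abs_sub_le_iff]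
  refine ⟨by linarith [asymptoticRank_add_le_add_tensorRank s t], ?_⟩
  have h := asymptoticRank_add_le_add_tensorRank (s + t) ((-1 : K) • t)
  rw [neg_one_smul, add_neg_cancel_right] at h
  have h₂ : (tensorRank (-t) : ℝ) ≤ tensorRank t := by
    have h' := tensorRank_smul_le (-1 : K) t
    rw [neg_one_smul] at h'
    exact_mod_cast h'
  linarith

/-- **`|R̃(t₀ + q•t₁) − R̃(t₀ + q'•t₁)| ≤ R(t₁)`** along any pencil. [cite: Strassen1988, Thm. 3.9] -/
theorem abs_asymptoticRank_line_sub_le (t₀ t₁ : ι → κ → μ → K) (q q' : K) :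
    |asymptoticRank (t₀ + q • t₁) - asymptoticRank (t₀ + q' • t₁)| ≤ tensorRank t₁ := by
  have e : t₀ + q' • t₁ + (q - q') • t₁ = t₀ + q • t₁ := by rw [sub_smul]; abel
  have h := abs_asymptoticRank_add_sub_le (t₀ + q' • t₁) ((q - q') • t₁)
  rw [e] at h
  exact h.trans (by exact_mod_cast tensorRank_smul_le (q - q') t₁)

end Spectral

/-! ## §2 The BCZ line: its direction is one triad -/

section BCZ

variable {K : Type} [Field K]

/-- **`E = 𝔖(1) − 𝔖(0)` is a single triad**, supported at the one entry
`(inr (1,0), (1,0), inr (0,0))` — the tree's coordinates for BCZ's `(γ − 1)·e₁₁ ⊗ e₁₁ ⊗ e₁₁`.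
[cite: BlaserChristandlZuiddam2017, Def. 5] -/
theorem fam_one_sub_fam_zero (K : Type) [Field K] :
    fam K 1 - fam K 0 = triad (fun a : Leaf2 => if a = Sum.inr (1, 0) then (1 : K) else 0)
      (fun x : Fin 2 × Fin 2 => if x = (1, 0) then (1 : K) else 0)
      (fun c : Leaf2 => if c = Sum.inr (0, 0) then (1 : K) else 0) := by
  funext a x c
  obtain ⟨x₁, x₂⟩ := x
  simp only [Pi.sub_apply, triad_apply]
  rcases a with ⟨i, l⟩ | ⟨i, l⟩ <;> rcases c with ⟨k, l'⟩ | ⟨k, l'⟩ <;> fin_cases i <;> fin_cases k <;>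
    fin_cases x₁ <;> fin_cases x₂ <;> fin_cases l <;> fin_cases l' <;>
    simp [matMulTensor, famW]

/-- **`R(𝔖(1) − 𝔖(0)) ≤ 1`.** [cite: BlaserChristandlZuiddam2017, Def. 5] -/
theorem tensorRank_fam_one_sub_fam_zero_le : tensorRank (fam K 1 - fam K 0) ≤ 1 := by
  rw [fam_one_sub_fam_zero K]
  exact tensorRank_le_of_eq_sum (r := 1) (fun _ => fun a : Leaf2 => if a = Sum.inr (1, 0) then (1 : K) else 0)
    (fun _ => fun x : Fin 2 × Fin 2 => if x = (1, 0) then (1 : K) else 0)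
    (fun _ => fun c : Leaf2 => if c = Sum.inr (0, 0) then (1 : K) else 0) (by simp)

/-- **Any two members differ by a multiple of `E`**: `𝔖(q) = 𝔖(q') + (q − q') • E`.
[cite: BlaserChristandlZuiddam2017, Def. 5] -/
theorem fam_eq_add_smul (q q' : K) : fam K q = fam K q' + (q - q') • (fam K 1 - fam K 0) := by
  rw [← line_eq_fam (K := K) q, ← line_eq_fam (K := K) q', sub_smul]
  abel

/-- **Rank-one coupling of spectral values on the BCZ line**: `|F(𝔖(q)) − F(𝔖(q'))| ≤ 1` for
every universal spectral point `F` and all `q, q'`, over any field.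
[cite: BlaserChristandlZuiddam2017, §2; Strassen1988, §2] -/
theorem abs_spectralPoint_fam_sub_le_one {F : SpectralMap K} (hF : IsUniversalSpectralPoint K F)
    (q q' : K) : |F (fam K q) - F (fam K q')| ≤ 1 := by
  have h := abs_spectralPoint_line_sub_le hF (fam K 0) (fam K 1 - fam K 0) q q'
  rw [line_eq_fam, line_eq_fam] at h
  exact h.trans (by exact_mod_cast tensorRank_fam_one_sub_fam_zero_le)

/-- **Rank-one coupling of asymptotic rank on the BCZ line**: `|R̃(𝔖(q)) − R̃(𝔖(q'))| ≤ 1`.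
[cite: BlaserChristandlZuiddam2017, §2; Strassen1988, Thm. 3.9] -/
theorem abs_asymptoticRank_fam_sub_le_one (q q' : K) :
    |asymptoticRank (fam K q) - asymptoticRank (fam K q')| ≤ 1 := by
  have h := abs_asymptoticRank_line_sub_le (fam K 0) (fam K 1 - fam K 0) q q'
  rw [line_eq_fam, line_eq_fam] at h
  exact h.trans (by exact_mod_cast tensorRank_fam_one_sub_fam_zero_le)

/-- `R̃(𝔖(q)) ≤ R̃(𝔖(q')) + 1`. [cite: BlaserChristandlZuiddam2017, §2] -/
theorem asymptoticRank_fam_le_add_one (q q' : K) :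
    asymptoticRank (fam K q) ≤ asymptoticRank (fam K q') + 1 := by
  have h := abs_asymptoticRank_fam_sub_le_one q q'
  rw [abs_sub_le_iff] at h
  linarith [h.1]

/-- `F(𝔖(q)) ≤ F(𝔖(q')) + 1` for every universal spectral point. [cite: BlaserChristandlZuiddam2017, §2] -/
theorem spectralPoint_fam_le_add_one {F : SpectralMap K} (hF : IsUniversalSpectralPoint K F)
    (q q' : K) : F (fam K q) ≤ F (fam K q') + 1 := by
  have h := abs_spectralPoint_fam_sub_le_one hF q q'
  rw [abs_sub_le_iff] at h
  linarith [h.1]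

end BCZ

/-! ## §3 Over `ℂ`: the window of width two around `2^ω` -/

section Complex

/-- **`2^ω − 1 ≤ R̃(𝔖(q))` for every `q`** (coupling with the summit member `𝔖(1) = ⟨2,2,2⟩`).
[cite: BlaserChristandlZuiddam2017, §2; ChristandlHoeberechtsNieuwboerVranaZuiddam2025, §1.2] -/
theorem rpow_omega_sub_one_le_asymptoticRank_fam (q : ℂ) :
    (2 : ℝ) ^ omega ℂ - 1 ≤ asymptoticRank (fam ℂ q) := by
  have h := asymptoticRank_fam_le_add_one (K := ℂ) 1 q
  rw [asymptoticRank_fam_one] at h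
  linarith

/-- **`R̃(𝔖(q)) ≤ 2^ω + 1` for every `q`.** [cite: BlaserChristandlZuiddam2017, §2] -/
theorem asymptoticRank_fam_le_rpow_omega_add_one (q : ℂ) :
    asymptoticRank (fam ℂ q) ≤ (2 : ℝ) ^ omega ℂ + 1 := by
  have h := asymptoticRank_fam_le_add_one (K := ℂ) q 1
  rwa [asymptoticRank_fam_one] at h

/-- **Every universal spectral value on the line is `≤ 2^ω + 1`.** [cite: Strassen1988, Thm. 3.9] -/
theorem spectralPoint_fam_le_rpow_omega_add_one {F : SpectralMap ℂ}
    (hF : IsUniversalSpectralPoint ℂ F) (q : ℂ) : F (fam ℂ q) ≤ (2 : ℝ) ^ omega ℂ + 1 :=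
  ((strassen_duality_asymptoticRank_holds ℂ (fam ℂ q)).1 F hF).trans
    (asymptoticRank_fam_le_rpow_omega_add_one q)

/-- **Generic window**: a dominant member satisfies `2^ω ≤ R̃(𝔖(q₀)) ≤ 2^ω + 1` — the generic
asymptotic rank of the stratum line exceeds the special (summit) value by at most one.
[cite: ChristandlHoeberechtsNieuwboerVranaZuiddam2025, Thm. 1.2; BlaserChristandlZuiddam2017, §2] -/
theorem generic_window {q₀ : ℂ} (hq₀ : ∀ q, asymptoticRank (fam ℂ q) ≤ asymptoticRank (fam ℂ q₀)) :
    (2 : ℝ) ^ omega ℂ ≤ asymptoticRank (fam ℂ q₀) ∧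
      asymptoticRank (fam ℂ q₀) ≤ (2 : ℝ) ^ omega ℂ + 1 :=
  ⟨rpow_omega_le_asymptoticRank_fam_of_dominant hq₀, asymptoticRank_fam_le_rpow_omega_add_one q₀⟩

/-- **The special/generic gap is at most one**: `R̃(𝔖(q₀)) − R̃(𝔖(q)) ≤ 1` for a dominant `q₀` and
any `q`, and it is nonnegative. [cite: BlaserChristandlZuiddam2017, §2] -/
theorem dominant_sub_le_one {q₀ : ℂ} (hq₀ : ∀ q, asymptoticRank (fam ℂ q) ≤ asymptoticRank (fam ℂ q₀))
    (q : ℂ) : 0 ≤ asymptoticRank (fam ℂ q₀) - asymptoticRank (fam ℂ q) ∧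
      asymptoticRank (fam ℂ q₀) - asymptoticRank (fam ℂ q) ≤ 1 :=
  ⟨by linarith [hq₀ q], by linarith [asymptoticRank_fam_le_add_one (K := ℂ) q₀ q]⟩

/-- **Additive exponent door at every member (including `q = 0`)**:
`R̃(𝔖(q)) ≤ r ⟹ ω ≤ log₂ (r + 1)`. [cite: BlaserChristandlZuiddam2017, §2; ChristandlHoeberechtsNieuwboerVranaZuiddam2025, §1.2] -/
theorem omega_le_logb_of_asymptoticRank_fam_le (q : ℂ) {r : ℝ} (h : asymptoticRank (fam ℂ q) ≤ r) :
    omega ℂ ≤ Real.logb 2 (r + 1) := by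
  have h₁ : (2 : ℝ) ^ omega ℂ ≤ r + 1 := by
    linarith [rpow_omega_sub_one_le_asymptoticRank_fam q]
  have hpos : 0 < r + 1 := lt_of_lt_of_le (Real.rpow_pos_of_pos (by norm_num) _) h₁
  exact (Real.le_logb_iff_rpow_le one_lt_two hpos).2 h₁

/-- **Exponent form**: `R̃(𝔖(q)) ≤ 2^τ − 1 ⟹ ω ≤ τ`, at every member.
[cite: BlaserChristandlZuiddam2017, §2] -/
theorem omega_le_of_asymptoticRank_fam_le_rpow_sub_one (q : ℂ) {τ : ℝ}
    (h : asymptoticRank (fam ℂ q) ≤ (2 : ℝ) ^ τ - 1) : omega ℂ ≤ τ := by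
  have h₁ : (2 : ℝ) ^ omega ℂ ≤ (2 : ℝ) ^ τ := by
    linarith [rpow_omega_sub_one_le_asymptoticRank_fam q]
  exact (Real.rpow_le_rpow_left_iff one_lt_two).1 h₁

/-! ### Under the summit `ω = 2` -/

/-- **Under `ω = 2` every member has `4 − 1 ≤ R̃(𝔖(q)) ≤ 5`** (the lower bound `4` itself, for all
`q`, is the flattening floor of the companion file). [cite: BlaserChristandlZuiddam2017, §2] -/
theorem asymptoticRank_fam_le_five_of_summit (hS : _root_.MatrixMultiplication) (q : ℂ) :
    asymptoticRank (fam ℂ q) ≤ 5 := by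
  have hω : omega ℂ = 2 := hS
  have h := asymptoticRank_fam_le_rpow_omega_add_one q
  rw [hω] at h
  norm_num at h
  linarith

/-- **Under `ω = 2` every universal spectral point satisfies `F(𝔖(1)) = 4`** (the summit member is
`⟨2,2,2⟩` in twisted coordinates: floor `4 ≤ F` from `FarEdgeDescentStratumPinning`, ceiling by
duality). [cite: Strassen1988, Thm. 3.9] -/
theorem spectralPoint_fam_one_eq_four_of_summit (hS : _root_.MatrixMultiplication)
    {F : SpectralMap ℂ} (hF : IsUniversalSpectralPoint ℂ F) : F (fam ℂ 1) = 4 := by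
  have hω : omega ℂ = 2 := hS
  have hlo : (4 : ℝ) ≤ F (fam ℂ 1) := four_le_spectralPoint_weightedStar (famW_ne_zero one_ne_zero) hF
  have hhi : F (fam ℂ 1) ≤ 4 := by
    have h := (strassen_duality_asymptoticRank_holds ℂ (fam ℂ 1)).1 F hF
    rw [asymptoticRank_fam_one, hω] at h
    norm_num at h
    exact h
  exact le_antisymm hhi hlo

/-- **Under `ω = 2`: `F(𝔖(q)) ≤ 5` for every universal spectral point and every member.**
[cite: BlaserChristandlZuiddam2017, §2; Strassen1988, Thm. 3.9] -/
theorem spectralPoint_fam_le_five_of_summit (hS : _root_.MatrixMultiplication)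
    {F : SpectralMap ℂ} (hF : IsUniversalSpectralPoint ℂ F) (q : ℂ) : F (fam ℂ q) ≤ 5 := by
  have h := spectralPoint_fam_le_add_one hF q 1
  rw [spectralPoint_fam_one_eq_four_of_summit hS hF] at h
  linarith

/-- **Under `ω = 2`, for `q ≠ 0`: `4 ≤ F(𝔖(q)) ≤ 5`** for every universal spectral point.
[cite: BlaserChristandlZuiddam2017, §2] -/
theorem spectralPoint_fam_mem_Icc_of_summit (hS : _root_.MatrixMultiplication)
    {F : SpectralMap ℂ} (hF : IsUniversalSpectralPoint ℂ F) {q : ℂ} (hq : q ≠ 0) :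
    (4 : ℝ) ≤ F (fam ℂ q) ∧ F (fam ℂ q) ≤ 5 :=
  ⟨four_le_spectralPoint_weightedStar (famW_ne_zero hq) hF, spectralPoint_fam_le_five_of_summit hS hF q⟩

/-- **Summit dichotomy on the BCZ line.** Under `ω = 2` the flat locus `{q : R̃(𝔖(q)) ≤ 4}` is
either all of `ℂ`, or it is finite, contains the summit member `q = 1`, and every member satisfies
`R̃(𝔖(q)) ≤ 5`: the generic value is then in `(4, 5]`.
[cite: ChristandlHoeberechtsNieuwboerVranaZuiddam2025, Thm. 1.2; BlaserChristandlZuiddam2017, §2] -/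
theorem summit_dichotomy (hS : _root_.MatrixMultiplication) :
    (∀ q : ℂ, asymptoticRank (fam ℂ q) ≤ 4) ∨
      ({q : ℂ | asymptoticRank (fam ℂ q) ≤ 4}.Finite ∧ (1 : ℂ) ∈ {q : ℂ | asymptoticRank (fam ℂ q) ≤ 4} ∧
        ∀ q : ℂ, asymptoticRank (fam ℂ q) ≤ 5) := by
  have hω : omega ℂ = 2 := hS
  have h1 : asymptoticRank (fam ℂ 1) ≤ 4 := by
    rw [asymptoticRank_fam_one, hω]; norm_num
  rcases flatLocus_eq_univ_or_finite 4 with h | h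
  · left
    intro q
    have hq : q ∈ {q : ℂ | asymptoticRank (fam ℂ q) ≤ 4} := by rw [h]; trivial
    exact hq
  · right
    exact ⟨h, h1, asymptoticRank_fam_le_five_of_summit hS⟩

/-- **Generic value under the summit**: a dominant `q₀` has `R̃(𝔖(q₀)) ∈ [4, 5]` if `ω = 2`;
contrapositively `R̃(𝔖(q₀)) > 5 ⟹ ω > 2`. [cite: BlaserChristandlZuiddam2017, §2] -/
theorem dominant_mem_Icc_of_summit (hS : _root_.MatrixMultiplication) {q₀ : ℂ}
    (hq₀ : ∀ q, asymptoticRank (fam ℂ q) ≤ asymptoticRank (fam ℂ q₀)) :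
    (4 : ℝ) ≤ asymptoticRank (fam ℂ q₀) ∧ asymptoticRank (fam ℂ q₀) ≤ 5 := by
  have hω : omega ℂ = 2 := hS
  refine ⟨?_, asymptoticRank_fam_le_five_of_summit hS q₀⟩
  have h := rpow_omega_le_asymptoticRank_fam_of_dominant hq₀
  rw [hω] at h
  norm_num at h
  exact h

/-- **Not-summit certificate from the generic value**: `5 < R̃(𝔖(q₀))` for some member refutes
`ω = 2`. [cite: BlaserChristandlZuiddam2017, §2] -/
theorem not_summit_of_five_lt {q : ℂ} (h : 5 < asymptoticRank (fam ℂ q)) :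
    ¬ _root_.MatrixMultiplication := fun hS =>
  absurd (asymptoticRank_fam_le_five_of_summit hS q) (not_le.2 h)

end Complex

end Summit.MatrixMultiplication.MatrixMultiplication.Theorems.FarEdgeDescentRankOneCoupling

end
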